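import Mathlib
import Summits.SmoothPoincare4.SmoothPoincare4.Theses.ConvexBisection
import Literature.Topology.FourManifolds.SimpleBranchedCover
import Literature.Topology.FourManifolds.ClosedSurfaceBraid
import Literature.Topology.FourManifolds.CircleSurgery

/-!
# Sketch — crux idea `unbraid-the-branch-link` (crux stmt-SmoothPoincare4-15086,
`ConvexBisection.PlanarAcyclicBisectionRigidity`, round 1, ideator k = 1)

First lemmas of the line, typed over EXISTING tree vocabulary
(`Literature.Topology.FourManifolds.IsSimpleBranchedCover`, `IsSortedClosedSurfaceBraid`):

* `UnlinkedBranchLocusStandard` — the ABSORBING TARGET of the walk: a homotopy 4-sphere that is a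
  simple branched cover of `S⁴` whose branch locus is a SPLIT UNLINK OF ROUND 2-SPHERES (each the
  unit sphere of a coordinate 3-plane inside its own smooth open 4-cell, the cells pairwise disjoint)
  is diffeomorphic to `S⁴`.  TRUE (folklore: Fox completion + cutting `S⁴` along the flat 3-balls;
  simple connectivity forces the sheet graph to be a tree, so the cover is an iterated union of
  punctured 4-spheres glued along 3-balls, i.e. `S⁴` by Palais–Cerf ball uniqueness).
* `CircleSurgeryOnCircleTimesSphereStandard` — the CLOSING STEP of the second idea
  `matching-sphere-gluck-reduction`: a homotopy 4-sphere obtained by surgery on an embedded circle of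
  `S¹ × S³` (tree predicate `IsCircleSurgery`, either framing) is `S⁴`.  TRUE (the homotopy-sphere
  hypothesis forces the circle to represent a generator of `π₁ = ℤ`; circles in a 4-manifold are
  isotopic iff homotopic, so it is isotopic to `S¹ × pt`, whose surgery is `D² × S² ∪ S¹ × B³ = S⁴` for
  any gluing).
* `SortedBraidCoverRigidity` — the TRANSFER statement `C⁺`: a homotopy 4-sphere that is a simple
  branched cover of `S⁴` along a SIGN-SORTED closed surface braid is `S⁴`.  Implied by SPC4
  (`of_smoothPoincare4`), hence refutable only by an exotic `S⁴`; implies the crux modulo the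
  (converse Loi–Piergallini–Wendl) dictionary "planar acyclic Stein bisection ⇒ sorted cover".
-/

noncomputable section

open scoped Manifold ContDiff Topology ContinuousMap

set_option linter.dupNamespace false
open Set Function
open Literature.Topology.FourManifolds

namespace Summit.SmoothPoincare4.SmoothPoincare4.Cruxes.PlanarAcyclicBisectionRigidity.Sketch

/-- Local notation: the model space `ℝ⁴`. -/
local notation "𝔼4" => EuclideanSpace ℝ (Fin 4)
/-- Local notation: the round 4-sphere (carrier of `SmoothPoincare4`). -/
local notation "𝕊⁴" => (Metric.sphere (0 : EuclideanSpace ℝ (Fin 5)) 1)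

/-- The round 2-sphere `{x₃ = 0, ‖x‖ = 1}` in the coordinate 3-plane of `ℝ⁴`: the model unknotted
2-sphere of a 4-cell (it bounds the flat 3-ball `{x₃ = 0, ‖x‖ ≤ 1}`). [folklore] -/
def roundTwoSphere : Set 𝔼4 := {x | x 3 = 0 ∧ ‖x‖ = 1}

/-- **Absorbing target of the walk.** A smooth homotopy 4-sphere `M` which is a simple branched
cover `p : M → S⁴` (product-tube presentation `IsSimpleBranchedCover f ν σ p d`, any degree `d`)
whose branch locus `range f` is a SPLIT UNLINK OF TRIVIAL 2-SPHERES — the images of the round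
2-sphere under finitely many smooth open 4-cells `e i : ℝ⁴ ↪ S⁴` with pairwise disjoint ranges —
is diffeomorphic to `S⁴`. [folklore] -/
def UnlinkedBranchLocusStandard : Prop :=
  ∀ (M : Type) [TopologicalSpace M] [T2Space M] [SecondCountableTopology M]
    [ChartedSpace 𝔼4 M] [IsManifold (𝓡 4) ∞ M], M ≃ₕ 𝕊⁴ →
  ∀ (S : Type) [TopologicalSpace S] [ChartedSpace (EuclideanSpace ℝ (Fin 2)) S]
    (f : S → 𝕊⁴) (ν : S × ℂ → 𝕊⁴) (σ : S × ℂ → M) (p : M → 𝕊⁴) (d : ℕ),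
    IsSimpleBranchedCover f ν σ p d →
    (∃ (c : ℕ) (e : Fin c → 𝔼4 → 𝕊⁴),
      (∀ i, Manifold.IsSmoothEmbedding (𝓡 4) (𝓡 4) ∞ (e i)) ∧
      (∀ i, IsOpen (range (e i))) ∧
      (∀ i j, i ≠ j → Disjoint (range (e i)) (range (e j))) ∧
      range f = ⋃ i, e i '' roundTwoSphere) →
    Nonempty (M ≃ₘ⟮𝓡 4, 𝓡 4⟯ 𝕊⁴)

/-- **Transfer statement `C⁺` (sorted-braid cover rigidity).** A smooth homotopy 4-sphere which is
a simple branched cover of `S⁴` along a closed surface braid in SIGN-SORTED position (positive twist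
points over the northern hemisphere, negative over the southern: `IsSortedClosedSurfaceBraid f`, the
tree's fixed coordinates `S⁴ ⊂ ℂ_z × ℂ_w × ℝ_t`) is diffeomorphic to `S⁴`. [folklore] -/
def SortedBraidCoverRigidity : Prop :=
  ∀ (M : Type) [TopologicalSpace M] [T2Space M] [SecondCountableTopology M]
    [ChartedSpace 𝔼4 M] [IsManifold (𝓡 4) ∞ M], M ≃ₕ 𝕊⁴ →
  ∀ (S : Type) [TopologicalSpace S] [ChartedSpace (EuclideanSpace ℝ (Fin 2)) S]
    (f : S → 𝕊⁴) (ν : S × ℂ → 𝕊⁴) (σ : S × ℂ → M) (p : M → 𝕊⁴) (d : ℕ),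
    IsSimpleBranchedCover f ν σ p d → IsSortedClosedSurfaceBraid S f →
    Nonempty (M ≃ₘ⟮𝓡 4, 𝓡 4⟯ 𝕊⁴)

/-- Local notation: the unit circle and the round 3-sphere. -/
local notation "𝕊¹" => (Metric.sphere (0 : EuclideanSpace ℝ (Fin 2)) 1)
local notation "𝕊³" => (Metric.sphere (0 : EuclideanSpace ℝ (Fin 4)) 1)

/-- **Closing step of `matching-sphere-gluck-reduction`.** A smooth homotopy 4-sphere `P` that is
obtained from `S¹ × S³` by surgery on a smoothly embedded circle `c` (the tree's relational
`IsCircleSurgery`: `P = (S¹ × S³ ∖ ν(c)) ∪ (D̊² × S²)`, either framing) is diffeomorphic to `S⁴`.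
In the line: `S¹ × S³ = D(X°)` is the double of the reduced filling `X° = X_{F ∖ c} ≅ S¹ × B³`
(Eliashberg: Stein fillings of `S¹ × S²` are `S¹ × B³`), the circle is the common vanishing cycle
`c` on the seam page, and `P = Σ(F, F')` is recovered by surgering it back. [folklore] -/
def CircleSurgeryOnCircleTimesSphereStandard : Prop :=
  ∀ (P : Type) [TopologicalSpace P] [T2Space P] [SecondCountableTopology P]
    [ChartedSpace 𝔼4 P] [IsManifold (𝓡 4) ∞ P], P ≃ₕ 𝕊⁴ →
  ∀ (c : 𝕊¹ → 𝕊¹ × 𝕊³),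
    IsCircleSurgery ((𝓡 1).prod (𝓡 3)) (𝓡 4) (𝕊¹ × 𝕊³) P c →
    Nonempty (P ≃ₘ⟮𝓡 4, 𝓡 4⟯ 𝕊⁴)

/-- KILL CRITERION for the closing step: implied by the summit. [folklore] -/
theorem circleSurgeryOnCircleTimesSphereStandard_of_smoothPoincare4 (h : _root_.SmoothPoincare4) :
    CircleSurgeryOnCircleTimesSphereStandard := by
  intro P _ _ _ _ _ e c _
  exact h P ‹_› ‹_› e

/-- KILL CRITERION for `C⁺`: it is implied by the summit (its conclusion is the summit's), so it is
refutable only by an exotic 4-sphere — exactly like the crux. [folklore] -/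
theorem sortedBraidCoverRigidity_of_smoothPoincare4 (h : _root_.SmoothPoincare4) :
    SortedBraidCoverRigidity := by
  intro M _ _ _ _ _ e S _ _ f ν σ p d _ _
  exact h M ‹_› ‹_› e

/-- Likewise for the absorbing target (which, unlike `C⁺`, is also provable outright). [folklore] -/
theorem unlinkedBranchLocusStandard_of_smoothPoincare4 (h : _root_.SmoothPoincare4) :
    UnlinkedBranchLocusStandard := by
  intro M _ _ _ _ _ e S _ _ f ν σ p d _ _
  exact h M ‹_› ‹_› e

end Summit.SmoothPoincare4.SmoothPoincare4.Cruxes.PlanarAcyclicBisectionRigidity.Sketch
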